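/-
Copyright (c) 2026 the pub-hodgecm-mathlib formalisation cell (harness21).  Prover seat hodgecm-mathlib-K2Liu-p11 (g5), Track B «K2-LIT»,
#184♮ = hLiu418 = `stmt-HodgeConjecture-24832`; socket #41 `sig_K2LiuSiegelEisensteinContinuation`, KIND W, brick (x-a-pres)(i): the ARCHIMEDEAN INTEGRABILITY
letter `hintArch` AT THE RECORD PRESENTATION — the bridge from ★ FILE 18 `K2LiuArchFlatTubePresentation` (a finite SUM of flat place-products read at the TRANSLATED
point) to ★ `K2LiuKindWArchLetterIntegrable` (a pure place-product), and the unconditional payer for a standard datum — KW desk F0P2-p08 (g3) `hpres` CENSUS RESULT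
2026-09-05T00:12:26Z (i); box K2Liu-audit1 (g2).  THEOREMS ONLY (no `def`, no `instance`, no notation, no named-fact hypothesis, no `sorry`, default heartbeats).
-/
import Summits.HodgeConjecture.HodgeConjecture.Theorems.K2LiuKindWArchLetterIntegrable   -- ★ (iii-arch-int) §1 `integrable_conj_unipDeltaChar_mul_of_presentation` (the engine), ★ FILE A, `kindWFinset`, `unipDeltaChar`
import Summits.HodgeConjecture.HodgeConjecture.Theorems.K2LiuArchFace                    -- ★ (E8rec) FILE 22: brings ★ FILE 18 `exists_flat_tube_presentation`, ★ FILE 21 `exists_frameCompact_conjugator`, ★ arch₄, reading frames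
import HarnessLib

/-!
# Crux `HLiu418`, socket #41, KIND W — brick (x-a-pres)(i) `K2LiuKindWArchLetterIntegrableBridge`: `hintArch` FROM THE FLAT TUBE PRESENTATION OF RECORD,
# AND UNCONDITIONALLY FOR THE (KW-fac) ARCHIMEDEAN FACTORS OF A STANDARD DATUM

Cell `hodgecm-mathlib`, crux item hLiu418 = `stmt-HodgeConjecture-24832` (helper lane `--supports … --as helper`, count-neutral), route of record
`HCCMUnconditional`; squad K2 ∕ K2Liu, road `K2_Liu`, socket #41, KIND W; KW desk of record F0P2-p08 (g3).
THE GAP CLOSED (desk census 00:12:26Z).  ★ `K2LiuKindWArchLetterIntegrable.hintArch_of_kindWArchLetter` wants the archimedean factor `FinfT j S h s` PRESENTED as ONE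
place-product `∏_w F_w(Fr a w)`; the (KW-fac) archimedean factor is `FinfT j S h s a = H_𝒦(a)^{2(s−s₀)} · A_j a` (★ `K2LiuKindWFactorizableDecomposition`, READING) and ★ FILE 18
`K2LiuArchFlatTubePresentation.exists_flat_tube_presentation` presents it as `H_𝒦(g⁻¹)^{2(s−s₀)} · Σ_r c_r ∏_w G_{r,w}(Fr (a·g) w)` — a finite SUM, a scalar, and the frame read at the
TRANSLATED point `a·g` (`g` = the datum's archimedean conjugator).  Integrability is LINEAR and ★ (iii-arch-int) §1 already carries a FREE right factor, so:
* §1 **ENGINE `integrable_conj_unipDeltaChar_mul_of_sumPresentation`** — frame letters of record BY VALUE (★ FILE A's variable block), any Haar `ν` on `N_Δ(L⁺⊗ℝ)`, a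
  translate `g`, a point `hpt`, `½ < re s`, flat families `G r w ∈ I_w(s, χ_{k_w})` with compact pictures `Q r w`, a scalar `γ₀`, coefficients `c r`, and
  `Φ a = γ₀ · Σ_r c_r ∏_w G_{r,w}(Fr (a·g) w)` ⊢ `a ↦ conj ψ_S(ι_∞ a) · Φ((w_Δ)_∞ · a · hpt)` is `ν`-integrable (per `r` ★ (iii-arch-int) §1 at the right factor `hpt·g`,
  `Integrable.const_mul`, `integrable_finsetSum`, `Integrable.congr`).
* §2 **`hintArch_of_sumPresentation`** — F0P2-p08's `hintArch` slot VERBATIM (`n := 2`, binder order `S h s j` = ★ ED. 4 :108) from the per-`(S,h,s,j)` EXISTENTIAL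
  sum-presentation letter (weakest form; inhabited by ★ FILE 18 ∘ the (KW-fac) reading).
* §3 **`hintArch_of_conjugator`** — OF RECORD modulo the conjugator letter `hconj` (★ FILE 20 `K2LiuArchFaceOfRecord`'s bytes): for a standard datum `𝒦′`, a Hecke character
  of unitary archimedean type `(t, 0)`, arch factors `A : Fin m → H_∞ → ℂ` carrying the (KW-fac) output letters VERBATIM (finPart-form Siegel law at `s₀`, `K_∞`-finiteness,
  continuity), Haar carriers `νinf T`, and the READING `hread : FinfT j S h s a = H_{𝒦′}(a)^{2(s−s₀)} · A j a` ⊢ the `hintArch` slot.  ALL frames are obtained INSIDE (★ arch₄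
  `exists_tubeFrame_arch₄` `choose`n over the complex places, Shimura shape ★ `isUnit_det_shimuraFrame` ∕ ★ `tw_ne_zero`, reading frames ★ `exists_readingFrame` + ★
  `tube_eq_of_chart_formula` + ★ `kappa_eq` — the ★ FILE 20 preamble), then ★ FILE 18 per `j` and §1.
* §4 **`hintArch_of_std` — UNCONDITIONAL**: §3 with `hconj` discharged by ★ FILE 21 `exists_frameCompact_conjugator` (as ★ `K2LiuArchFace.archFace`).  Inputs = the (KW-fac)
  arch clauses per `j` + `hread` (at the tie: `fun _ _ _ _ _ => rfl`) + `ht` + Haar carriers.  NO parity hypothesis on `t` (integrability needs no JUNCTION) and NO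
  definite∕indefinite split of the index.
[Shimura1997, §16.4, §18.4] [KudlaRallis1994, §1–§2] [Tan1999, §1, §3] [BorelJacquet1979, §4.1] [MoeglinWaldspurger1995, II.1.5].
HONEST LABEL.  Count-neutral helper; closes no socket by itself: `HC_CM` is proved only modulo the 7 printed citations (2 remaining named inputs:
hLiu418 = `stmt-HodgeConjecture-24832`, h413 = `stmt-HodgeConjecture-24833`) until rung 0 closes.  NOT HERE (by value): that the carriers `νinf T` are Haar (★ Φ3b for the
carriers of record; the carrier head's missing clause, K2E4-p10), and the (KW-fac) output letters themselves (★ `exists_kindW_factorization`).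

## References
* [Shimura1997] G. Shimura, *Euler Products and Eisenstein Series*, CBMS 93 (1997), §16.4, §18.4 (archimedean factors; absolute convergence of the intertwining integral).
* [KudlaRallis1994] S. Kudla, S. Rallis, Ann. of Math. 140 (1994), §1–§2 (Euler factorisation of the Fourier coefficients of Siegel Eisenstein series).
* [Tan1999] V. Tan, *Poles of Siegel Eisenstein series on U(n,n)*, Canad. J. Math. 51 (1999), §1 p. 166, §3 (standard sections `Φ_∞ ⊗ Φ_f`).
* [BorelJacquet1979] A. Borel, H. Jacquet, Proc. Symp. Pure Math. 33 (1979), §4.1 (archimedean components, `K_∞`-finite vectors).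
* [MoeglinWaldspurger1995] C. Mœglin, J.-L. Waldspurger, *Spectral Decomposition and Eisenstein Series* (1995), II.1.5 (Fourier–Whittaker coefficients).
-/

set_option autoImplicit false
set_option linter.dupNamespace false -- the mandated namespace repeats `HodgeConjecture.HodgeConjecture`

noncomputable section

open scoped Matrix ComplexConjugate NNReal Classical
open Complex Matrix MeasureTheory MeasureTheory.Measure NumberField NumberField.InfinitePlace IsDedekindDomain
open Literature.NumberTheory.ModularForms.SiegelUpperHalfSpace (moeb denom)
open Literature.NumberTheory.Automorphic Literature.NumberTheory.Automorphic.UnitaryGroup Literature.NumberTheory.GaloisRepresentations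
open Literature.NumberTheory.GelbartRogawski1991 Literature.NumberTheory.GelbartRogawski1991.GRConstruction
open Literature.NumberTheory.GelbartRogawski1991.UnitaryDualPair
open Literature.NumberTheory.K2Lit.SiegelDoubled

namespace Summit.HodgeConjecture.HodgeConjecture.Cruxes.HLiu418.K2LiuKindWArchLetterIntegrableBridge

open K2LiuU22CompactPictureDefs K2LiuArchInducedTubeDefs K2LiuSiegelUnipotentLocalDefs K2LiuArchSWSpanningDefs
open K2LiuSiegelUnipotentFourierDefs (skewMatrices unipDeltaChar)
open K2LiuSiegelEisensteinKindWLetters (kindWFinset)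
open K2LiuHermitianTubeFrameSign (exists_tubeFrame_arch₄)
open K2LiuHermitianTubeFrameArch (tw_ne_zero)
open K2LiuArchSiegelCharacterTube (isUnit_det_shimuraFrame)
open K2LiuArchReadingFrame (exists_readingFrame)
open K2LiuArchSiegelCharacterTubeConsumer (tube_eq_of_chart_formula)
open K2LiuArchFrameBridge (kappa_eq)
open K2LiuArchFlatTubePresentation (exists_flat_tube_presentation)
open K2LiuArchFrameCompactConjugator (exists_frameCompact_conjugator)
open K2LiuKindWArchLetterIntegrable (integrable_conj_unipDeltaChar_mul_of_presentation)

variable (L : Type) [Field L] [NumberField L] [IsCMField L]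
variable {N₀ M₀ : ℕ} (e : Fin N₀ × Fin M₀ ≃ Fin 2)
  (dV : Fin N₀ → L) (hdV : ∀ i, IsCMField.complexConj L (dV i) = dV i)
  (dW : Fin M₀ → L) (hdW : ∀ i, IsCMField.complexConj L (dW i) = dW i)
  [MeasurableSpace ↥(unipDeltaArch L e dV hdV dW hdW)] [BorelSpace ↥(unipDeltaArch L e dV hdV dW hdW)]

/-! ## §1 ENGINE: a finite sum of flat place-products read at a translated point -/

section Engine

variable (T Tinv : {w : InfinitePlace L // w.IsComplex} → Matrix (Fin 2 ⊕ Fin 2) (Fin 2 ⊕ Fin 2) ℂ)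
  (Fr : UnitaryGroup.arch (Fp L) L (IsCMField.complexConj L) (2 + 2) (hermD L e dV hdV dW hdW) →
    {w : InfinitePlace L // w.IsComplex} → Matrix (Fin 2 ⊕ Fin 2) (Fin 2 ⊕ Fin 2) ℂ)
  (hFr : ∀ a w, Fr a w = T w * Matrix.reindex (e₂ (n := 2)).symm (e₂ (n := 2)).symm
    (((UnitaryGroup.archAt (Fp L) L (IsCMField.complexConj L) (2 + 2) (hermD L e dV hdV dW hdW) w
      (UnitaryGroup.complexConj_smul_infinitePlace L w.1) (IsCMField.complexConj_ne_one L) a :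
        UnitaryGroup.archLocal L (2 + 2) (hermD L e dV hdV dW hdW) w) : GL (Fin (2 + 2)) ℂ) : Matrix (Fin (2 + 2)) (Fin (2 + 2)) ℂ) * Tinv w)
  (hT2 : ∀ w, Tinv w * T w = 1)
  (hTU : ∀ w (g : GL (Fin (2 + 2)) ℂ), g ∈ UnitaryGroup.archLocal L (2 + 2) (hermD L e dV hdV dW hdW) w →
    (T w * Matrix.reindex (e₂ (n := 2)).symm (e₂ (n := 2)).symm (g : Matrix _ _ ℂ) * Tinv w)ᴴ * Matrix.J (Fin 2) ℂ *
      (T w * Matrix.reindex (e₂ (n := 2)).symm (e₂ (n := 2)).symm (g : Matrix _ _ ℂ) * Tinv w) = Matrix.J (Fin 2) ℂ)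

include hFr hT2 hTU in
/-- **ENGINE — `a ↦ conj ψ_S(ι_∞ a) · Φ((w_Δ)_∞ · a · hpt)` IS INTEGRABLE ON `N_Δ(L⁺ ⊗ ℝ)`** for `½ < re s` when `Φ : H_∞ → ℂ` is presented as a finite SUM of flat place-products read
at a TRANSLATED point: `Φ a = γ₀ · Σ_r c_r ∏_w G_{r,w}(Fr (a·g) w)` with `G_{r,w} ∈ I_w(s, χ_{k_w})` flat of compact picture `Q_{r,w}` (★ FILE 18's shape).  Per `r`, ★ (iii-arch-int) §1
`integrable_conj_unipDeltaChar_mul_of_presentation` at the free right factor `hpt · g` (`(w_Δ·a·hpt)·g = w_Δ·a·(hpt·g)`), then `Integrable.const_mul`, `integrable_finsetSum` and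
`Integrable.congr`.  Frame letters of record `(T, Tinv, Fr, hFr, hT1, hT2, hTU, hTiv, hTN)` and the anti-diagonal reading `hBC` BY VALUE. [cite: Shimura1997, §16.4]
[cite: KudlaRallis1994, §1–§2] [cite: BorelJacquet1979, §4.1] -/
theorem integrable_conj_unipDeltaChar_mul_of_sumPresentation (hT1 : ∀ w, T w * Tinv w = 1)
    (hTiv : ∀ w (u : GL (Fin (2 + 2)) ℂ), u ∈ UnitaryGroup.archLocal L (2 + 2) (hermD L e dV hdV dW hdW) w →
      K2LiuSiegelUnipotentLocalDefs.IsUnipM (n := 2) (u : Matrix (Fin (2 + 2)) (Fin (2 + 2)) ℂ) →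
        ∃ b : Matrix (Fin 2) (Fin 2) ℂ, bᴴ = b ∧ T w * Matrix.reindex (e₂ (n := 2)).symm (e₂ (n := 2)).symm (u : Matrix _ _ ℂ) * Tinv w = fromBlocks 1 b 0 1)
    (hTN : ∀ w (b : Matrix (Fin 2) (Fin 2) ℂ), bᴴ = b → ∃ u : GL (Fin (2 + 2)) ℂ,
      u ∈ UnitaryGroup.archLocal L (2 + 2) (hermD L e dV hdV dW hdW) w ∧ K2LiuSiegelUnipotentLocalDefs.IsUnipM (n := 2) (u : Matrix (Fin (2 + 2)) (Fin (2 + 2)) ℂ) ∧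
        T w * Matrix.reindex (e₂ (n := 2)).symm (e₂ (n := 2)).symm (u : Matrix _ _ ℂ) * Tinv w = fromBlocks 1 b 0 1)
    (ν : Measure ↥(unipDeltaArch L e dV hdV dW hdW)) [ν.IsHaarMeasure]
    (B C : {w : InfinitePlace L // w.IsComplex} → Matrix (Fin 2) (Fin 2) ℂ) (hBC : ∀ w, T w * fromBlocks 1 0 0 (-1) * Tinv w = fromBlocks 0 (B w) (C w) 0)
    (k : {w : InfinitePlace L // w.IsComplex} → ℤ) {m : ℕ} (Q : Fin m → {w : InfinitePlace L // w.IsComplex} → Carrier)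
    (g hpt : UnitaryGroup.arch (Fp L) L (IsCMField.complexConj L) (2 + 2) (hermD L e dV hdV dW hdW))
    (S : Matrix (Fin 2) (Fin 2) L) {s : ℂ} (hs : 1 / 2 < s.re)
    (G : Fin m → {w : InfinitePlace L // w.IsComplex} → Matrix (Fin 2 ⊕ Fin 2) (Fin 2 ⊕ Fin 2) ℂ → ℂ)
    (hG : ∀ r w, IsArchSiegelSection (fun z : ℂ => (conj z / ((‖z‖ : ℝ) : ℂ)) ^ (k w)) s (G r w))
    (hGQ : ∀ r w, ∀ (v : Matrix (Fin 2) (Fin 2) ℂ), vᴴ * v = 1 → ∀ hv : v.det ≠ 0,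
      (G r w) ((2 : ℂ)⁻¹ • fromBlocks (1 + v) (-(I • (1 - v))) (I • (1 - v)) (1 + v) : Matrix (Fin 2 ⊕ Fin 2) (Fin 2 ⊕ Fin 2) ℂ) = evalAt v hv (Q r w))
    (γ₀ : ℂ) (c : Fin m → ℂ)
    (Φ : UnitaryGroup.arch (Fp L) L (IsCMField.complexConj L) (2 + 2) (hermD L e dV hdV dW hdW) → ℂ)
    (hΦ : ∀ a : UnitaryGroup.arch (Fp L) L (IsCMField.complexConj L) (2 + 2) (hermD L e dV hdV dW hdW), Φ a = γ₀ * ∑ r, c r * ∏ w, G r w (Fr (a * g) w)) :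
    Integrable (fun a : ↥(unipDeltaArch L e dV hdV dW hdW) =>
      conj (unipDeltaChar L e dV hdV dW hdW S
          (UnitaryGroup.archToAdelic (Fp L) L (IsCMField.complexConj L) (2 + 2) (hermD L e dV hdV dW hdW)
            (a : UnitaryGroup.arch (Fp L) L (IsCMField.complexConj L) (2 + 2) (hermD L e dV hdV dW hdW))) : ℂ) *
        Φ (UnitaryGroup.archPart (Fp L) L (IsCMField.complexConj L) (2 + 2) (hermD L e dV hdV dW hdW) (weylDelta L e dV hdV dW hdW) *
            (a : UnitaryGroup.arch (Fp L) L (IsCMField.complexConj L) (2 + 2) (hermD L e dV hdV dW hdW)) * hpt)) ν := by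
  -- per `r`: ★ (iii-arch-int) §1 at the right factor `hpt * g`, with the UNtranslated flat place-product `x ↦ ∏_w G r w (Fr x w)`
  have hr : ∀ r : Fin m, Integrable (fun a : ↥(unipDeltaArch L e dV hdV dW hdW) =>
      conj (unipDeltaChar L e dV hdV dW hdW S
          (UnitaryGroup.archToAdelic (Fp L) L (IsCMField.complexConj L) (2 + 2) (hermD L e dV hdV dW hdW)
            (a : UnitaryGroup.arch (Fp L) L (IsCMField.complexConj L) (2 + 2) (hermD L e dV hdV dW hdW))) : ℂ) *
        (fun x => ∏ w, G r w (Fr x w))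
          (UnitaryGroup.archPart (Fp L) L (IsCMField.complexConj L) (2 + 2) (hermD L e dV hdV dW hdW) (weylDelta L e dV hdV dW hdW) *
            (a : UnitaryGroup.arch (Fp L) L (IsCMField.complexConj L) (2 + 2) (hermD L e dV hdV dW hdW)) * (hpt * g))) ν := fun r =>
    integrable_conj_unipDeltaChar_mul_of_presentation L e dV hdV dW hdW T Tinv Fr hFr hT2 hTU hT1 hTiv hTN ν B C hBC k (Q r) (hpt * g) S hs (G r) (hG r) (hGQ r)
      (fun x => ∏ w, G r w (Fr x w)) (fun _ => rfl)
  -- the finite sum, the coefficients and the scalar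
  have hsum : Integrable (fun a : ↥(unipDeltaArch L e dV hdV dW hdW) => γ₀ * ∑ r, c r *
      (conj (unipDeltaChar L e dV hdV dW hdW S
          (UnitaryGroup.archToAdelic (Fp L) L (IsCMField.complexConj L) (2 + 2) (hermD L e dV hdV dW hdW)
            (a : UnitaryGroup.arch (Fp L) L (IsCMField.complexConj L) (2 + 2) (hermD L e dV hdV dW hdW))) : ℂ) *
        (fun x => ∏ w, G r w (Fr x w))
          (UnitaryGroup.archPart (Fp L) L (IsCMField.complexConj L) (2 + 2) (hermD L e dV hdV dW hdW) (weylDelta L e dV hdV dW hdW) *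
            (a : UnitaryGroup.arch (Fp L) L (IsCMField.complexConj L) (2 + 2) (hermD L e dV hdV dW hdW)) * (hpt * g)))) ν :=
    (integrable_finsetSum _ fun r _ => (hr r).const_mul (c r)).const_mul γ₀
  refine hsum.congr (Filter.Eventually.of_forall fun a => ?_)
  -- pointwise: `γ₀ · Σ_r c_r (W · P_r) = W · (γ₀ · Σ_r c_r P_r)` and `(w_Δ·a·hpt)·g = w_Δ·a·(hpt·g)`
  simp only [hΦ, mul_assoc, Finset.mul_sum]
  exact Finset.sum_congr rfl fun r _ => by ring

end Engine

/-! ## §2 The `hintArch` slot from the per-`(S,h,s,j)` sum-presentation letter -/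

section Slot

variable (T Tinv : {w : InfinitePlace L // w.IsComplex} → Matrix (Fin 2 ⊕ Fin 2) (Fin 2 ⊕ Fin 2) ℂ)
  (Fr : UnitaryGroup.arch (Fp L) L (IsCMField.complexConj L) (2 + 2) (hermD L e dV hdV dW hdW) →
    {w : InfinitePlace L // w.IsComplex} → Matrix (Fin 2 ⊕ Fin 2) (Fin 2 ⊕ Fin 2) ℂ)
  (hFr : ∀ a w, Fr a w = T w * Matrix.reindex (e₂ (n := 2)).symm (e₂ (n := 2)).symm
    (((UnitaryGroup.archAt (Fp L) L (IsCMField.complexConj L) (2 + 2) (hermD L e dV hdV dW hdW) w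
      (UnitaryGroup.complexConj_smul_infinitePlace L w.1) (IsCMField.complexConj_ne_one L) a :
        UnitaryGroup.archLocal L (2 + 2) (hermD L e dV hdV dW hdW) w) : GL (Fin (2 + 2)) ℂ) : Matrix (Fin (2 + 2)) (Fin (2 + 2)) ℂ) * Tinv w)
  (hT2 : ∀ w, Tinv w * T w = 1)
  (hTU : ∀ w (g : GL (Fin (2 + 2)) ℂ), g ∈ UnitaryGroup.archLocal L (2 + 2) (hermD L e dV hdV dW hdW) w →
    (T w * Matrix.reindex (e₂ (n := 2)).symm (e₂ (n := 2)).symm (g : Matrix _ _ ℂ) * Tinv w)ᴴ * Matrix.J (Fin 2) ℂ *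
      (T w * Matrix.reindex (e₂ (n := 2)).symm (e₂ (n := 2)).symm (g : Matrix _ _ ℂ) * Tinv w) = Matrix.J (Fin 2) ℂ)

include hFr hT2 hTU in
/-- **THE `hintArch` SLOT FROM THE SUM-PRESENTATION LETTER.**  Frame letters of record BY VALUE; the bad set `T₀`, Haar carriers `νinf T`; the archimedean factors `FinfT` (by value,
(KW-fac)) with, per `(S, h, s, j)` on `{2∕2 < re s}`, `det ↑S ≠ 0`, the weakest presentation letter: there EXIST a translate `g`, a scalar `γ₀`, finitely many coefficients
`c r`, weights `k_w`, compact pictures `Q r w` and flat families `G r w ∈ I_w(s, χ_{k_w})` (`cp = Q r w`) with `FinfT j S h s a = γ₀ · Σ_r c_r ∏_w G_{r,w}(Fr (a·g) w)` — the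
output shape of ★ FILE 18 composed with the (KW-fac) reading.  THEN F0P2-p08's `hintArch` slot VERBATIM (§1 at `hpt := h_∞`, `½ < 1 < re s`).
[cite: Shimura1997, §16.4, §18.4] [cite: KudlaRallis1994, §1–§2] [cite: MoeglinWaldspurger1995, II.1.5] -/
theorem hintArch_of_sumPresentation (hT1 : ∀ w, T w * Tinv w = 1)
    (hTiv : ∀ w (u : GL (Fin (2 + 2)) ℂ), u ∈ UnitaryGroup.archLocal L (2 + 2) (hermD L e dV hdV dW hdW) w →
      K2LiuSiegelUnipotentLocalDefs.IsUnipM (n := 2) (u : Matrix (Fin (2 + 2)) (Fin (2 + 2)) ℂ) →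
        ∃ b : Matrix (Fin 2) (Fin 2) ℂ, bᴴ = b ∧ T w * Matrix.reindex (e₂ (n := 2)).symm (e₂ (n := 2)).symm (u : Matrix _ _ ℂ) * Tinv w = fromBlocks 1 b 0 1)
    (hTN : ∀ w (b : Matrix (Fin 2) (Fin 2) ℂ), bᴴ = b → ∃ u : GL (Fin (2 + 2)) ℂ,
      u ∈ UnitaryGroup.archLocal L (2 + 2) (hermD L e dV hdV dW hdW) w ∧ K2LiuSiegelUnipotentLocalDefs.IsUnipM (n := 2) (u : Matrix (Fin (2 + 2)) (Fin (2 + 2)) ℂ) ∧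
        T w * Matrix.reindex (e₂ (n := 2)).symm (e₂ (n := 2)).symm (u : Matrix _ _ ℂ) * Tinv w = fromBlocks 1 b 0 1)
    (B C : {w : InfinitePlace L // w.IsComplex} → Matrix (Fin 2) (Fin 2) ℂ) (hBC : ∀ w, T w * fromBlocks 1 0 0 (-1) * Tinv w = fromBlocks 0 (B w) (C w) 0)
    (T₀ : Finset (HeightOneSpectrum (𝓞 (Fp L))))
    (νinf : Finset (HeightOneSpectrum (𝓞 (Fp L))) → Measure ↥(unipDeltaArch L e dV hdV dW hdW)) [∀ T' : Finset (HeightOneSpectrum (𝓞 (Fp L))), (νinf T').IsHaarMeasure]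
    {m : ℕ}
    (FinfT : Fin m → skewMatrices ((IsCMField.complexConj L : L ≃ₐ[Fp L] L) : L →+* L) ((gramR L e dV hdV dW hdW).map (algebraMap (Fp L) L)) →
      HA L e dV hdV dW hdW → ℂ → UnitaryGroup.arch (Fp L) L (IsCMField.complexConj L) (2 + 2) (hermD L e dV hdV dW hdW) → ℂ)
    (hpres : ∀ (S : skewMatrices ((IsCMField.complexConj L : L ≃ₐ[Fp L] L) : L →+* L) ((gramR L e dV hdV dW hdW).map (algebraMap (Fp L) L))) (h : HA L e dV hdV dW hdW)
      (s : ℂ) (j : Fin m), ((2 : ℕ) : ℝ) / 2 < s.re → (S : Matrix (Fin 2) (Fin 2) L).det ≠ 0 →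
      ∃ (g : UnitaryGroup.arch (Fp L) L (IsCMField.complexConj L) (2 + 2) (hermD L e dV hdV dW hdW)) (γ₀ : ℂ) (m' : ℕ) (c : Fin m' → ℂ)
        (k : {w : InfinitePlace L // w.IsComplex} → ℤ) (Q : Fin m' → {w : InfinitePlace L // w.IsComplex} → Carrier)
        (G : Fin m' → {w : InfinitePlace L // w.IsComplex} → Matrix (Fin 2 ⊕ Fin 2) (Fin 2 ⊕ Fin 2) ℂ → ℂ),
        (∀ r w, IsArchSiegelSection (fun z : ℂ => (conj z / ((‖z‖ : ℝ) : ℂ)) ^ (k w)) s (G r w)) ∧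
        (∀ r w, ∀ (v : Matrix (Fin 2) (Fin 2) ℂ), vᴴ * v = 1 → ∀ hv : v.det ≠ 0,
          (G r w) ((2 : ℂ)⁻¹ • fromBlocks (1 + v) (-(I • (1 - v))) (I • (1 - v)) (1 + v) : Matrix (Fin 2 ⊕ Fin 2) (Fin 2 ⊕ Fin 2) ℂ) = evalAt v hv (Q r w)) ∧
        ∀ a : UnitaryGroup.arch (Fp L) L (IsCMField.complexConj L) (2 + 2) (hermD L e dV hdV dW hdW), FinfT j S h s a = γ₀ * ∑ r, c r * ∏ w, G r w (Fr (a * g) w)) :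
    ∀ (S : skewMatrices ((IsCMField.complexConj L : L ≃ₐ[Fp L] L) : L →+* L) ((gramR L e dV hdV dW hdW).map (algebraMap (Fp L) L))) (h : HA L e dV hdV dW hdW)
      (s : ℂ) (j : Fin m), ((2 : ℕ) : ℝ) / 2 < s.re → (S : Matrix (Fin 2) (Fin 2) L).det ≠ 0 →
      Integrable (fun a : ↥(unipDeltaArch L e dV hdV dW hdW) =>
        conj (unipDeltaChar L e dV hdV dW hdW (S : Matrix (Fin 2) (Fin 2) L)
            (UnitaryGroup.archToAdelic (Fp L) L (IsCMField.complexConj L) (2 + 2) (hermD L e dV hdV dW hdW)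
              (a : UnitaryGroup.arch (Fp L) L (IsCMField.complexConj L) (2 + 2) (hermD L e dV hdV dW hdW))) : ℂ) *
          FinfT j S h s (UnitaryGroup.archPart (Fp L) L (IsCMField.complexConj L) (2 + 2) (hermD L e dV hdV dW hdW) (weylDelta L e dV hdV dW hdW) *
              (a : UnitaryGroup.arch (Fp L) L (IsCMField.complexConj L) (2 + 2) (hermD L e dV hdV dW hdW)) *
              UnitaryGroup.archPart (Fp L) L (IsCMField.complexConj L) (2 + 2) (hermD L e dV hdV dW hdW) h))
        (νinf (kindWFinset L e dV hdV dW hdW T₀ (S : Matrix (Fin 2) (Fin 2) L) h)) := by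
  intro S h s j hs hdet
  have hs' : 1 / 2 < s.re := by norm_num at hs; linarith
  obtain ⟨g, γ₀, m', c, k, Q, G, hG, hGQ, hpr⟩ := hpres S h s j hs hdet
  exact integrable_conj_unipDeltaChar_mul_of_sumPresentation L e dV hdV dW hdW T Tinv Fr hFr hT2 hTU hT1 hTiv hTN
    (νinf (kindWFinset L e dV hdV dW hdW T₀ (S : Matrix (Fin 2) (Fin 2) L) h)) B C hBC k Q g
    (UnitaryGroup.archPart (Fp L) L (IsCMField.complexConj L) (2 + 2) (hermD L e dV hdV dW hdW) h) (S : Matrix (Fin 2) (Fin 2) L) hs' G hG hGQ γ₀ c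
    (FinfT j S h s) hpr

end Slot

/-! ## §3 OF RECORD modulo the conjugator letter: frames obtained inside, ★ FILE 18 per `j` -/

/-- **`hintArch` OF RECORD, MODULO THE CONJUGATOR LETTER.**  Inputs: `dV dW` non-zero; a Hecke character `χ` of unitary archimedean type `(t, 0)` (`ht`); the conjugator
letter `hconj` (★ FILE 20 `K2LiuArchFaceOfRecord.archFace_of_conjugator`'s bytes: for every standard `𝒦′` and the EXPLICIT Shimura frame `(T_w, T_w⁻¹)` of ★ arch₄, some
`g ∈ H_∞` conjugates `Stab(i1)`-elements into `𝒦′.K`; discharged in §4); a standard datum `𝒦′`, `s₀`, and arch factors `A : Fin m → H_∞ → ℂ` with the (KW-fac) output letters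
VERBATIM per `j` — the finPart-form Siegel law at `s₀` (`hAlaw`), `K_∞`-finiteness w.r.t. `𝒦′` (`hfin`), continuity (`hAc`); the bad set `T₀`, Haar carriers `νinf T`; the
archimedean factors `FinfT` with the READING `hread : FinfT j S h s a = H_{𝒦′}(a)^{2(s−s₀)} · A j a` (★ `K2LiuKindWFactorizableDecomposition`).  THEN the `hintArch` slot
VERBATIM.  Road: the ★ FILE 20 preamble (frames of record ★ `exists_tubeFrame_arch₄`, Shimura shape ★ `isUnit_det_shimuraFrame`, reading frames ★ `exists_readingFrame` +
★ `tube_eq_of_chart_formula` + ★ `kappa_eq`), ★ `isArchSiegelDeltaSection_of_finPart_eq_one`, ★ FILE 18 `exists_flat_tube_presentation` per `j`, §1 with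
`γ₀ := H_{𝒦′}(g⁻¹)^{2(s−s₀)}`, `G r w := ‖j(·, i1)‖^{2(s₀−s)} · F r w`, `k_w := −t_w`, `hpt := h_∞`. [cite: Shimura1997, §16.4, §18.4] [cite: KudlaRallis1994, §1–§2]
[cite: Tan1999, §1, §3] [cite: BorelJacquet1979, §4.1] -/
theorem hintArch_of_conjugator (hdV0 : ∀ i, dV i ≠ 0) (hdW0 : ∀ i, dW i ≠ 0)
    {χ : HeckeCharacter L} {t : InfinitePlace L → ℤ} (ht : χ.HasUnitaryArchType t 0)
    (hconj : ∀ 𝒦' : IwasawaDatum L e dV hdV dW hdW, 𝒦'.IsStd →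
      ∀ T Tinv : {w : InfinitePlace L // w.IsComplex} → Matrix (Fin 2 ⊕ Fin 2) (Fin 2 ⊕ Fin 2) ℂ,
        (∀ w, T w = fromBlocks (diagonal (fun k => (Real.sqrt (|(w.1.embedding (dV (e.symm k).1 * dW (e.symm k).2)).re| / 2) : ℂ))) (diagonal (fun k => (Real.sqrt (|(w.1.embedding (dV (e.symm k).1 * dW (e.symm k).2)).re| / 2) : ℂ)))
          (diagonal (fun k => I * ((((w.1.embedding (dV (e.symm k).1 * dW (e.symm k).2)).re / |(w.1.embedding (dV (e.symm k).1 * dW (e.symm k).2)).re|) * Real.sqrt (|(w.1.embedding (dV (e.symm k).1 * dW (e.symm k).2)).re| / 2) : ℝ) : ℂ))) (-diagonal (fun k => I * ((((w.1.embedding (dV (e.symm k).1 * dW (e.symm k).2)).re / |(w.1.embedding (dV (e.symm k).1 * dW (e.symm k).2)).re|) * Real.sqrt (|(w.1.embedding (dV (e.symm k).1 * dW (e.symm k).2)).re| / 2) : ℝ) : ℂ)))) →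
        (∀ w, Tinv w = fromBlocks (diagonal (fun k => (((Real.sqrt (|(w.1.embedding (dV (e.symm k).1 * dW (e.symm k).2)).re| / 2))⁻¹ / 2 : ℝ) : ℂ))) (-diagonal (fun k => I * (((Real.sqrt (|(w.1.embedding (dV (e.symm k).1 * dW (e.symm k).2)).re| / 2))⁻¹ * ((w.1.embedding (dV (e.symm k).1 * dW (e.symm k).2)).re / |(w.1.embedding (dV (e.symm k).1 * dW (e.symm k).2)).re|) / 2 : ℝ) : ℂ)))
          (diagonal (fun k => (((Real.sqrt (|(w.1.embedding (dV (e.symm k).1 * dW (e.symm k).2)).re| / 2))⁻¹ / 2 : ℝ) : ℂ))) (diagonal (fun k => I * (((Real.sqrt (|(w.1.embedding (dV (e.symm k).1 * dW (e.symm k).2)).re| / 2))⁻¹ * ((w.1.embedding (dV (e.symm k).1 * dW (e.symm k).2)).re / |(w.1.embedding (dV (e.symm k).1 * dW (e.symm k).2)).re|) / 2 : ℝ) : ℂ)))) →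
        ∃ g : UnitaryGroup.arch (Fp L) L (IsCMField.complexConj L) (2 + 2) (hermD L e dV hdV dW hdW), ∀ k : UnitaryGroup.arch (Fp L) L (IsCMField.complexConj L) (2 + 2) (hermD L e dV hdV dW hdW),
          (∀ w, moeb (T w * Matrix.reindex (e₂ (n := 2)).symm (e₂ (n := 2)).symm (((UnitaryGroup.archAt (Fp L) L (IsCMField.complexConj L) (2 + 2) (hermD L e dV hdV dW hdW) w (UnitaryGroup.complexConj_smul_infinitePlace L w.1) (IsCMField.complexConj_ne_one L) k : UnitaryGroup.archLocal L (2 + 2) (hermD L e dV hdV dW hdW) w) : GL (Fin (2 + 2)) ℂ) : Matrix (Fin (2 + 2)) (Fin (2 + 2)) ℂ) * Tinv w)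
            (I • (1 : Matrix (Fin 2) (Fin 2) ℂ)) = I • 1) →
          (UnitaryGroup.archToAdelic (Fp L) L (IsCMField.complexConj L) (2 + 2) (hermD L e dV hdV dW hdW) (g * k * g⁻¹) : HA L e dV hdV dW hdW) ∈ 𝒦'.K)
    (𝒦' : IwasawaDatum L e dV hdV dW hdW) (h𝒦' : 𝒦'.IsStd) (s₀ : ℂ) {m : ℕ}
    (A : Fin m → UnitaryGroup.arch (Fp L) L (IsCMField.complexConj L) (2 + 2) (hermD L e dV hdV dW hdW) → ℂ)
    (hAlaw : ∀ j, ∀ p : HA L e dV hdV dW hdW, IsSiegelDelta L e dV hdV dW hdW p → UnitaryGroup.finPart (Fp L) L (IsCMField.complexConj L) (2 + 2) (hermD L e dV hdV dW hdW) p = 1 →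
      ∀ x : UnitaryGroup.arch (Fp L) L (IsCMField.complexConj L) (2 + 2) (hermD L e dV hdV dW hdW),
        A j (UnitaryGroup.archPart (Fp L) L (IsCMField.complexConj L) (2 + 2) (hermD L e dV hdV dW hdW) p * x) = siegelDeltaCharacter L e dV hdV dW hdW χ s₀ p * A j x)
    (hfin : ∀ j, ∃ V : Submodule ℂ (UnitaryGroup.arch (Fp L) L (IsCMField.complexConj L) (2 + 2) (hermD L e dV hdV dW hdW) → ℂ), FiniteDimensional ℂ V ∧ A j ∈ V ∧
      ∀ a₀ : UnitaryGroup.arch (Fp L) L (IsCMField.complexConj L) (2 + 2) (hermD L e dV hdV dW hdW),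
        (UnitaryGroup.archToAdelic (Fp L) L (IsCMField.complexConj L) (2 + 2) (hermD L e dV hdV dW hdW) a₀ : HA L e dV hdV dW hdW) ∈ 𝒦'.K → ∀ G ∈ V, (fun x => G (x * a₀)) ∈ V)
    (hAc : ∀ j, Continuous (A j))
    (T₀ : Finset (HeightOneSpectrum (𝓞 (Fp L))))
    (νinf : Finset (HeightOneSpectrum (𝓞 (Fp L))) → Measure ↥(unipDeltaArch L e dV hdV dW hdW)) [∀ T' : Finset (HeightOneSpectrum (𝓞 (Fp L))), (νinf T').IsHaarMeasure]
    (FinfT : Fin m → skewMatrices ((IsCMField.complexConj L : L ≃ₐ[Fp L] L) : L →+* L) ((gramR L e dV hdV dW hdW).map (algebraMap (Fp L) L)) →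
      HA L e dV hdV dW hdW → ℂ → UnitaryGroup.arch (Fp L) L (IsCMField.complexConj L) (2 + 2) (hermD L e dV hdV dW hdW) → ℂ)
    (hread : ∀ (S : skewMatrices ((IsCMField.complexConj L : L ≃ₐ[Fp L] L) : L →+* L) ((gramR L e dV hdV dW hdW).map (algebraMap (Fp L) L))) (h : HA L e dV hdV dW hdW)
      (s : ℂ) (j : Fin m) (a : UnitaryGroup.arch (Fp L) L (IsCMField.complexConj L) (2 + 2) (hermD L e dV hdV dW hdW)),
      FinfT j S h s a = (((modDelta L e dV hdV dW hdW (𝒦'.pPart (UnitaryGroup.archToAdelic (Fp L) L (IsCMField.complexConj L) (2 + 2) (hermD L e dV hdV dW hdW) a)) : ℝ) : ℂ) ^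
        (2 * (s - s₀))) * A j a) :
    ∀ (S : skewMatrices ((IsCMField.complexConj L : L ≃ₐ[Fp L] L) : L →+* L) ((gramR L e dV hdV dW hdW).map (algebraMap (Fp L) L))) (h : HA L e dV hdV dW hdW)
      (s : ℂ) (j : Fin m), ((2 : ℕ) : ℝ) / 2 < s.re → (S : Matrix (Fin 2) (Fin 2) L).det ≠ 0 →
      Integrable (fun a : ↥(unipDeltaArch L e dV hdV dW hdW) =>
        conj (unipDeltaChar L e dV hdV dW hdW (S : Matrix (Fin 2) (Fin 2) L)
            (UnitaryGroup.archToAdelic (Fp L) L (IsCMField.complexConj L) (2 + 2) (hermD L e dV hdV dW hdW)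
              (a : UnitaryGroup.arch (Fp L) L (IsCMField.complexConj L) (2 + 2) (hermD L e dV hdV dW hdW))) : ℂ) *
          FinfT j S h s (UnitaryGroup.archPart (Fp L) L (IsCMField.complexConj L) (2 + 2) (hermD L e dV hdV dW hdW) (weylDelta L e dV hdV dW hdW) *
              (a : UnitaryGroup.arch (Fp L) L (IsCMField.complexConj L) (2 + 2) (hermD L e dV hdV dW hdW)) *
              UnitaryGroup.archPart (Fp L) L (IsCMField.complexConj L) (2 + 2) (hermD L e dV hdV dW hdW) h))
        (νinf (kindWFinset L e dV hdV dW hdW T₀ (S : Matrix (Fin 2) (Fin 2) L) h)) := by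
  -- the tube frames of record at every complex place (★ arch₄), `choose`n once
  choose T Tinv h1 h2 hTU hTS hTiv hTN hTV hW hTdef hTinvdef using fun w : {w : InfinitePlace L // w.IsComplex} =>
    exists_tubeFrame_arch₄ L e dV hdV dW hdW w (UnitaryGroup.complexConj_smul_infinitePlace L w.1) hdV0 hdW0
  choose B C hCu hBC using hW
  have hDC := fun w : {w : InfinitePlace L // w.IsComplex} => isUnit_det_shimuraFrame (n := 2)
    (fun k => (w.1.embedding (dV (e.symm k).1 * dW (e.symm k).2)).re)
    (tw_ne_zero L e dV hdV dW hdW w (UnitaryGroup.complexConj_smul_infinitePlace L w.1) hdV0 hdW0)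
  obtain ⟨Fr, hFr⟩ : ∃ Fr : UnitaryGroup.arch (Fp L) L (IsCMField.complexConj L) (2 + 2) (hermD L e dV hdV dW hdW) → {w : InfinitePlace L // w.IsComplex} → Matrix (Fin 2 ⊕ Fin 2) (Fin 2 ⊕ Fin 2) ℂ,
      ∀ k w, Fr k w = T w * Matrix.reindex (e₂ (n := 2)).symm (e₂ (n := 2)).symm (((UnitaryGroup.archAt (Fp L) L (IsCMField.complexConj L) (2 + 2) (hermD L e dV hdV dW hdW) w (UnitaryGroup.complexConj_smul_infinitePlace L w.1) (IsCMField.complexConj_ne_one L) k : UnitaryGroup.archLocal L (2 + 2) (hermD L e dV hdV dW hdW) w) : GL (Fin (2 + 2)) ℂ) : Matrix (Fin (2 + 2)) (Fin (2 + 2)) ℂ) * Tinv w :=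
    ⟨_, fun _ _ => rfl⟩
  -- reading frames
  obtain ⟨fr, hfrM, hfrc, -⟩ := exists_readingFrame L e dV hdV dW hdW hdV0 hdW0
  have hfrτ : ∀ w (u : Matrix.unitaryGroup (Fin 2) ℂ),
      T w * Matrix.reindex (e₂ (n := 2)).symm (e₂ (n := 2)).symm (((fr w u : UnitaryGroup.archLocal L (2 + 2) (hermD L e dV hdV dW hdW) w) : GL (Fin (2 + 2)) ℂ) :
        Matrix (Fin (2 + 2)) (Fin (2 + 2)) ℂ) * Tinv w =
      (2 : ℂ)⁻¹ • fromBlocks (1 + (u : Matrix (Fin 2) (Fin 2) ℂ)) (-(I • (1 - (u : Matrix (Fin 2) (Fin 2) ℂ)))) (I • (1 - (u : Matrix (Fin 2) (Fin 2) ℂ))) (1 + (u : Matrix (Fin 2) (Fin 2) ℂ)) := by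
    intro w u
    have hG := hfrM w u
    rw [← hTdef w, ← hTinvdef w] at hG
    rw [tube_eq_of_chart_formula (T w) (Tinv w) (h1 w) hG, kappa_eq]
  -- the conjugator letter, read in the frame
  obtain ⟨g, hg⟩ := hconj 𝒦' h𝒦' T Tinv hTdef hTinvdef
  have hg' : ∀ k : UnitaryGroup.arch (Fp L) L (IsCMField.complexConj L) (2 + 2) (hermD L e dV hdV dW hdW), (∀ w, moeb (Fr k w) (I • (1 : Matrix (Fin 2) (Fin 2) ℂ)) = I • 1) →
      (UnitaryGroup.archToAdelic (Fp L) L (IsCMField.complexConj L) (2 + 2) (hermD L e dV hdV dW hdW) (g * k * g⁻¹) : HA L e dV hdV dW hdW) ∈ 𝒦'.K :=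
    fun k hk => hg k fun w => by rw [← hFr]; exact hk w
  intro S h s j hs hdet
  have hs' : 1 / 2 < s.re := by norm_num at hs; linarith
  -- (KW-fac)'s arch letters of `A j` in the ★ (law)-dictionary currency
  have hA : IsArchSiegelDeltaSection L e dV hdV dW hdW χ s₀ (A j) := isArchSiegelDeltaSection_of_finPart_eq_one L e dV hdV dW hdW (hAlaw j)
  have hK : IsArchKFinite L e dV hdV dW hdW 𝒦' (A j) := hfin j
  -- ★ FILE 18: the flat tube presentation of `H(a)^{2(s−s₀)}·A j a` at the translated point
  obtain ⟨m', c, Q, F, hFs, hQs, hpres⟩ := exists_flat_tube_presentation L e dV hdV hdV0 dW hdW hdW0 T Tinv Fr hFr h1 h2 hTU hTS hTV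
    (fun w => diagonal fun k => (Real.sqrt (|(w.1.embedding (dV (e.symm k).1 * dW (e.symm k).2)).re| / 2) : ℂ))
    (fun w => diagonal fun k => I * ((((w.1.embedding (dV (e.symm k).1 * dW (e.symm k).2)).re / |(w.1.embedding (dV (e.symm k).1 * dW (e.symm k).2)).re|) *
      Real.sqrt (|(w.1.embedding (dV (e.symm k).1 * dW (e.symm k).2)).re| / 2) : ℝ) : ℂ))
    hTdef (fun w => (hDC w).1) (fun w => (hDC w).2) fr hfrc hfrτ 𝒦' g hg' ht s₀ hA hK (hAc j)
  -- §1 with `γ₀ := H(g⁻¹)^{2(s−s₀)}`, `G r w := ‖j(·,i1)‖^{2(s₀−s)}·F r w`, `k_w := −t_w`, `hpt := h_∞`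
  exact integrable_conj_unipDeltaChar_mul_of_sumPresentation L e dV hdV dW hdW T Tinv Fr hFr h2 hTU h1 hTiv hTN
    (νinf (kindWFinset L e dV hdV dW hdW T₀ (S : Matrix (Fin 2) (Fin 2) L) h)) B C hBC (fun w => -(t w.1)) Q g
    (UnitaryGroup.archPart (Fp L) L (IsCMField.complexConj L) (2 + 2) (hermD L e dV hdV dW hdW) h) (S : Matrix (Fin 2) (Fin 2) L) hs'
    (fun r w x => (((‖(denom x (I • (1 : Matrix (Fin 2) (Fin 2) ℂ))).det‖ : ℝ) : ℂ) ^ (2 * (s₀ - s))) * F r w x) (hFs s) (hQs s)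
    ((((modDelta L e dV hdV dW hdW (𝒦'.pPart (UnitaryGroup.archToAdelic (Fp L) L (IsCMField.complexConj L) (2 + 2) (hermD L e dV hdV dW hdW) g⁻¹)) : ℝ) : ℂ) ^
      (2 * (s - s₀)))) c (FinfT j S h s) (fun a => by rw [hread, hpres s a])

/-! ## §4 UNCONDITIONAL for a standard datum: the conjugator discharged (★ FILE 21) -/

/-- **`hintArch` FOR THE (KW-fac) ARCHIMEDEAN FACTORS OF A STANDARD DATUM — UNCONDITIONAL.**  §3 with the conjugator letter discharged by ★ FILE 21
`K2LiuArchFrameCompactConjugator.exists_frameCompact_conjugator` (as ★ `K2LiuArchFace.archFace`).  Inputs: `dV dW` non-zero, `χ` of unitary archimedean type `(t,0)`, a standard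
`𝒦′`, `s₀`, the arch factors `A j` with the three (KW-fac) output clauses VERBATIM (★ `K2LiuKindWFactorizableDecomposition.exists_kindW_factorization`), the bad set `T₀`, Haar
carriers `νinf T`, and the reading `hread` of `FinfT` (`rfl` at the tie).  THEN F0P2-p08's `hintArch` slot VERBATIM — no parity hypothesis, no definite∕indefinite split.
[cite: Shimura1997, §16.4, §18.4] [cite: KudlaRallis1994, §1–§2] [cite: Tan1999, §1, §3] [cite: BorelJacquet1979, §4.1] -/
theorem hintArch_of_std (hdV0 : ∀ i, dV i ≠ 0) (hdW0 : ∀ i, dW i ≠ 0)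
    {χ : HeckeCharacter L} {t : InfinitePlace L → ℤ} (ht : χ.HasUnitaryArchType t 0)
    (𝒦' : IwasawaDatum L e dV hdV dW hdW) (h𝒦' : 𝒦'.IsStd) (s₀ : ℂ) {m : ℕ}
    (A : Fin m → UnitaryGroup.arch (Fp L) L (IsCMField.complexConj L) (2 + 2) (hermD L e dV hdV dW hdW) → ℂ)
    (hAlaw : ∀ j, ∀ p : HA L e dV hdV dW hdW, IsSiegelDelta L e dV hdV dW hdW p → UnitaryGroup.finPart (Fp L) L (IsCMField.complexConj L) (2 + 2) (hermD L e dV hdV dW hdW) p = 1 →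
      ∀ x : UnitaryGroup.arch (Fp L) L (IsCMField.complexConj L) (2 + 2) (hermD L e dV hdV dW hdW),
        A j (UnitaryGroup.archPart (Fp L) L (IsCMField.complexConj L) (2 + 2) (hermD L e dV hdV dW hdW) p * x) = siegelDeltaCharacter L e dV hdV dW hdW χ s₀ p * A j x)
    (hfin : ∀ j, ∃ V : Submodule ℂ (UnitaryGroup.arch (Fp L) L (IsCMField.complexConj L) (2 + 2) (hermD L e dV hdV dW hdW) → ℂ), FiniteDimensional ℂ V ∧ A j ∈ V ∧
      ∀ a₀ : UnitaryGroup.arch (Fp L) L (IsCMField.complexConj L) (2 + 2) (hermD L e dV hdV dW hdW),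
        (UnitaryGroup.archToAdelic (Fp L) L (IsCMField.complexConj L) (2 + 2) (hermD L e dV hdV dW hdW) a₀ : HA L e dV hdV dW hdW) ∈ 𝒦'.K → ∀ G ∈ V, (fun x => G (x * a₀)) ∈ V)
    (hAc : ∀ j, Continuous (A j))
    (T₀ : Finset (HeightOneSpectrum (𝓞 (Fp L))))
    (νinf : Finset (HeightOneSpectrum (𝓞 (Fp L))) → Measure ↥(unipDeltaArch L e dV hdV dW hdW)) [∀ T' : Finset (HeightOneSpectrum (𝓞 (Fp L))), (νinf T').IsHaarMeasure]
    (FinfT : Fin m → skewMatrices ((IsCMField.complexConj L : L ≃ₐ[Fp L] L) : L →+* L) ((gramR L e dV hdV dW hdW).map (algebraMap (Fp L) L)) →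
      HA L e dV hdV dW hdW → ℂ → UnitaryGroup.arch (Fp L) L (IsCMField.complexConj L) (2 + 2) (hermD L e dV hdV dW hdW) → ℂ)
    (hread : ∀ (S : skewMatrices ((IsCMField.complexConj L : L ≃ₐ[Fp L] L) : L →+* L) ((gramR L e dV hdV dW hdW).map (algebraMap (Fp L) L))) (h : HA L e dV hdV dW hdW)
      (s : ℂ) (j : Fin m) (a : UnitaryGroup.arch (Fp L) L (IsCMField.complexConj L) (2 + 2) (hermD L e dV hdV dW hdW)),
      FinfT j S h s a = (((modDelta L e dV hdV dW hdW (𝒦'.pPart (UnitaryGroup.archToAdelic (Fp L) L (IsCMField.complexConj L) (2 + 2) (hermD L e dV hdV dW hdW) a)) : ℝ) : ℂ) ^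
        (2 * (s - s₀))) * A j a) :
    ∀ (S : skewMatrices ((IsCMField.complexConj L : L ≃ₐ[Fp L] L) : L →+* L) ((gramR L e dV hdV dW hdW).map (algebraMap (Fp L) L))) (h : HA L e dV hdV dW hdW)
      (s : ℂ) (j : Fin m), ((2 : ℕ) : ℝ) / 2 < s.re → (S : Matrix (Fin 2) (Fin 2) L).det ≠ 0 →
      Integrable (fun a : ↥(unipDeltaArch L e dV hdV dW hdW) =>
        conj (unipDeltaChar L e dV hdV dW hdW (S : Matrix (Fin 2) (Fin 2) L)
            (UnitaryGroup.archToAdelic (Fp L) L (IsCMField.complexConj L) (2 + 2) (hermD L e dV hdV dW hdW)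
              (a : UnitaryGroup.arch (Fp L) L (IsCMField.complexConj L) (2 + 2) (hermD L e dV hdV dW hdW))) : ℂ) *
          FinfT j S h s (UnitaryGroup.archPart (Fp L) L (IsCMField.complexConj L) (2 + 2) (hermD L e dV hdV dW hdW) (weylDelta L e dV hdV dW hdW) *
              (a : UnitaryGroup.arch (Fp L) L (IsCMField.complexConj L) (2 + 2) (hermD L e dV hdV dW hdW)) *
              UnitaryGroup.archPart (Fp L) L (IsCMField.complexConj L) (2 + 2) (hermD L e dV hdV dW hdW) h))
        (νinf (kindWFinset L e dV hdV dW hdW T₀ (S : Matrix (Fin 2) (Fin 2) L) h)) :=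
  hintArch_of_conjugator L e dV hdV dW hdW hdV0 hdW0 ht
    (fun _ h𝒦'' T Tinv hTdef hTinvdef => exists_frameCompact_conjugator L e dV hdV hdV0 dW hdW hdW0 h𝒦'' T Tinv hTdef hTinvdef)
    𝒦' h𝒦' s₀ A hAlaw hfin hAc T₀ νinf FinfT hread

end Summit.HodgeConjecture.HodgeConjecture.Cruxes.HLiu418.K2LiuKindWArchLetterIntegrableBridge

end
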